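import Mathlib
import HarnessLib
import HarnessLib.Audit
import Summits.AtomisticToContinuum.Statement
import Literature.MathematicalPhysics.QuantumLattice.SpinSystem
import Summits.AtomisticToContinuum.BoseEinsteinCondensation.Theorems.BECInfraredBoundAssembly
import Summits.AtomisticToContinuum.BoseEinsteinCondensation.Theorems.BECInfraredBoundBecFreeGas
import HarnessLib.Audit.Status.Attr

/-!
Route: BECHierarchicalRetention

DORMANT since 2026-08-25T13:21:27Z (reconciler: no traction for 7.7 d (last activity item-evidence-added at 2026-08-17T19:15:47Z); parked, not closed — `ledger route dormant route-AtomisticToContinuum-BECHierarchicalRetention --off` to ) — unstaffed, not closed; items shared with open routes are served there. `ledger route dormant <id> --off` reactivates.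

# Route BECHierarchicalRetention — BEC = bounded loss of block-constant occupation over dyadic
scales; the loss law is exact in the hierarchical gas

It suffices to show X = GeometricRetention ∧ WindowCondensation (conforming gen-2 realisation of
card
hierarchical-bose-hubbard-exact-gluing; D-0027 §2.1). Tile the Dirichlet box of side L = (N/ρ)^{1/3}
by the 8^m open dyadic
cubes of level m (side s_m = L/2^m) and let occ_m(Ψ) := Σ_C ⟨φ_C, γ_Ψ φ_C⟩ be the number of
particles in BLOCK-CONSTANT modes
φ_C = s_m^{-3/2} 1_C. occ_m is non-decreasing in m (refinement), occ_0 is the occupation of the zero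
mode φ₀ = L^{-3/2}1_box, and
occ_{m+1} − occ_m = (1/8) Σ_parents Σ_{sibling pairs} ⟨(a_C − a_C′)†(a_C − a_C′)⟩ is the occupation
of the RELATIVE (Josephson)
modes of sibling sub-cubes. BEC in the thermodynamic limit is therefore exactly: the total loss of
block-constant occupation from a
window level K (cube side ≍ ρ^{-1/3}) down to level 0 stays below the window occupation.
WindowCondensation (rank 4): occ_K ≥ N/2
at the interparticle scale (kinetic gap where it is a theorem). GeometricRetention (rank 2): above
that scale the per-level loss
obeys the geometric law occ_{m+1} − occ_m ≤ (1/8)(ρ^{-1/3}/s_{m+1})·N, uniformly in N, for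
near-minimisers and every genuinely
interacting v (total ≤ N/4). The free gas (v a.e. 0, where the sine profile violates any such law)
is the shared support
FreeGasZeroMode. X ∧ FreeGasZeroMode → X_B1 (ZeroModeOccupation, stmt-0686) is the provable-now
support ContinuumTelescoping, and
X_B1 → Statement is the proved theorem AtomisticToContinuum.BECInfraredBound.bec_of_zeroMode. The
card's hierarchical hard-core gas
is the one interacting model in which the per-level loss law is an EXACT finite-dimensional
recursion (level-n coupling sees
sub-blocks only through (N_B, a_B)); its theorems SiblingCoherence (rank 3) and HierCondensation
(rank 5) are the route's laboratory
cruxes — ranked and staffed, deliberately NOT hypotheses of `closes` (no hierarchical → Euclidean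
transfer exists or is claimed).
Lean: `GeometricRetention ∧ WindowCondensation ∧ FreeGasZeroMode`

## Assembly
Pure logic plus one proved theorem: `closes (hR : GeometricRetention) (hW : WindowCondensation) (hF
: FreeGasZeroMode)
(hT : ContinuumTelescoping) : _root_.BoseEinsteinCondensation :=
AtomisticToContinuum.BECInfraredBound.bec_of_zeroMode (hT hR hW hF)`
(glue.lean; rc 0 with axioms propext / Classical.choice / Quot.sound in Sketch.lean).
ContinuumTelescoping is the provable-now
bookkeeping from X ∧ FreeGasZeroMode to X_B1 (stmt-0686, the rank-0 target), bec_of_zeroMode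
(Theorems/BECInfraredBoundAssembly.lean,
proved) is X_B1 → Statement. The laboratory items (SiblingCoherence, HierCondensation and their
supports) are NOT hypotheses of
`closes`: SiblingCoherence → CoherenceTelescoping → LevelOneDicke → HierCondensation is the route's
second, self-contained spine,
displayed because it is where the per-level law of GeometricRetention is an exact recursion — no
hierarchical → Euclidean
implication exists or is claimed.

Rationale: WHY THIS LINE. Dyson made the 1/r² Ising chain tractable by a hierarchical model in which the
renormalisation group is exact (Dyson1969;
Bleher–Major ran it through the Goldstone scales of the classical vector model, BleherMajor1984,
BleherMajor1989); the card makes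
the same move on the Bose gas: with hierarchical hopping the Anderson–Leggett Josephson block
induction (Leggett2001 §VI,
⟨δθ²⟩ ≍ √(E_C/E_J), summable iff d_s > 1) is an identity-level quantum recursion over solved
complete-graph levels (Toth1990,
Penrose1991, Kirson2000, BruDorlas2003). New in gen-2 is the continuum dictionary that makes the
line DECIDE the Statement: the
Dirichlet kinetic energy dominates the hierarchical (Haar) kinetic energy built on dyadic
block-constant modes with weights
π²/(4(m+1)²s_m²) (PoincareCascade: Neumann Poincaré–Wirtinger applied recursively, the log-loss of
piecewise-constant multilevel
splittings — BPX-type norms are H^s-stable only for s < 1/2, doi:10.1090/S0025-5718-1990-1023042-6 —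
being harmless because the
Josephson margin per level is s⁴), and in these coordinates BEC is literally a bounded-total-loss
statement for the monotone
sequence occ_m, whose per-level increment is the sibling relative-mode occupation that the
hierarchical coupling penalises
exactly. Imported areas: exact hierarchical RG (constructive field theory), exactly solvable
mean-field bosons, Josephson/rotor
energetics, multilevel (Haar) space splittings from numerical analysis. State of the art in the
ENERGY currency: block-constant
kinetic localisation propagates condensation scale by scale (LSSY2005 Lemma 4.1; Fournais2020;
Chong–Liang–Nam arXiv:2510.20493
eq. (3), Q_Ω ≤ ε(−Δ) + C_ε Σ_j Q_{Ω_j}; Junge2026 = arXiv:2603.20776 Thm 1/3 and Cor. 6, depletion ≤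
CNρR²a(ρa³)^{1/2+η}), reaching
R ≍ a(ρa³)^{-3/4−η} with an allowance that GROWS like R² per step; GeometricRetention is the same
propagation in the OCCUPATION
currency with an allowance that SHRINKS like 1/s per step — the statement no energetic engine
reaches and the laboratory's gapped
level recursion is designed to deliver. Versus prior/parallel routes: BECInfraredBound bounds
plane-wave occupations mode by mode;
the retired BECScaleChaining telescopes the coherent AMPLITUDE Σ√n_C (norm defect); here the
functional is the linear block-constant
OCCUPATION, whose increments are energies of an explicit comparison Hamiltonian and whose law is a
theorem-candidate in the
laboratory; the window sits at ρ^{-1/3}, inside the proved kinetic-gap regime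
(Literature.Barriers.AtomisticToContinuum.KineticGapLengthScales),
not at the healing length. Negatives index (6 entries,
2026-08-15): none concerns block occupations, hierarchical models or X_B1.

RANKED CRUXES. #0 ZeroModeOccupation (target) — X_B1 (stmt-AtomisticToContinuum-0686, shared
verbatim with BECInfraredBound / BECStoquasticCensoring): for every repulsive finite-range v, at all
small densities, for all large N there is δ > 0 such that every δ-near-minimiser of the Dirichlet
N-body energy in the box of side (N/ρ)^{1/3} has occupation of the normalised constant mode φ₀ ≥ cN.
It is what X ∧ FreeGasZeroMode deliver through ContinuumTelescoping (c = 1/4 in the interacting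
case). (why it might fail: it is thermodynamic-limit BEC in zero-mode Dirichlet form (LSSY2005 Ch.
5, open); fails only if near-minimisers condense into a mode asymptotically orthogonal to φ₀,
against the flat Gross–Pitaevskii bulk profile.) [LSSY2005, PenroseOnsager1956, Fournais2020,
Junge2026]
#2 GeometricRetention (crux) — GEOMETRIC RETENTION OF BLOCK-CONSTANT OCCUPATION (continuum face of
card H1). For every repulsive finite-range v that is not a.e. zero on (0,∞) there is ρ₀ > 0 such
that for 0 < ρ < ρ₀, for all large N, some δ > 0 and every δ-near-minimiser Ψ of the Dirichlet
energy in the box of side L = (N/ρ)^{1/3}: at every dyadic level m whose child cubes have side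
s_{m+1} = L/2^{m+1} ≥ ρ^{-1/3}, occ_{m+1}(Ψ) ≤ occ_m(Ψ) + (1/8)(ρ^{-1/3}/s_{m+1})·N, where occ_m = Σ
over the 8^m level-m cubes C of ⟨φ_C, γ_Ψ φ_C⟩, φ_C = s_m^{-3/2}1_C. The increment is the occupation
of the 7·8^m sibling relative modes (Haar details) at scale s_{m+1}; Bogoliubov + GP-wall heuristics
give loss/N ≍ √(ρa³)(ξ/s)² log(s/ξ) in the bulk above the healing length ξ, ≍ ρa²s below it, and ≍
ξ²/(Ls) from the Dirichlet wall layer — all inside the inverse-linear budget once ρ^{-1/3} ≫ a, with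
slack (ρa³)^{1/3} at s ≍ ξ and N^{1/3} at the octant level. Summed over levels the budget is ≤ N/4.
[difficulty: open-problem] (why it might fail: At the top level it asserts octant relative-mode
occupation ≤ N^{2/3}/4 uniformly in N — the thermodynamic difficulty itself; energetic engines
(Junge2026 Cor 6, arXiv:2510.20493) pay ∝ s² per step and stop at a(ρa³)^{-3/4}; an infrared anomaly
beyond Bogoliubov (n_k ≫ 1/(kξ)) would break the law.) [Leggett2001, LSSY2005, Junge2026,
arXiv:2510.20493, Fournais2020, BleherMajor1989]
#3 SiblingCoherence (crux) — LABORATORY TWIN OF RANK 2 (card H1 typed; = retired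
stmt-AtomisticToContinuum-6186 verbatim): in the hard-core Bose gas on the b-adic hierarchy Λ_M =
(Fin M → Fin b) with Dyson-hierarchical hopping H = Σ_n q^n Σ_{x∼_n y}(δ_xy − b^{-n}) a†_x a_y
(one-body spectrum q^n, NO uniform gap, d_s = 2 ln b/ln(1/q); b = 8, q = 1/4 is the dyadic d_s = 3
point), for q b² > 1 there is a filling window ν₁b^M ≤ N ≤ ν₀b^M in which every sector ground state
has, at every level ℓ and for every pair of sibling blocks B ≠ B′, Re⟨A_B†A_B′⟩ ≥ 0 and Re⟨A_B†A_B′⟩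
≥ (1 − Cθ^{ℓ+1})·½(⟨A_B†A_B⟩ + ⟨A_B′†A_B′⟩) with θ < 1 (predicted θ = (qb²)^{-1/2} = √(E_C/E_J) per
level; big blocks MORE coherent). Here the level-n coupling sees sub-blocks only through (N_B′,
a_B′) (CasimirConservation), level 1 is the solved complete graph (LevelOneDicke), and the per-level
step is a finite-dimensional gapped problem: the one interacting model where the rank-2 law should
be provable as stated. [difficulty: L] (why it might fail: level-1 blocks are supersites with U_eff
= 2q/b, hopping q²/b: mean-field Mott lobes at fillings k/b when q(b−1) ≲ 0.34 (inside q b² > 1 for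
q < 0.049, b = 8); if incoherent low levels feed E_J ∝ f_ℓ → 0 upward, no window ν₀ works.)
[Leggett2001, FisherEtAl1989, Penrose1991, BleherMajor1984, MaghrebiGongGorshkov2017]
#4 WindowCondensation (crux) — WINDOW CONDENSATION AT THE INTERPARTICLE SCALE (the kinetic gap used
exactly where it is a theorem). For every repulsive finite-range v not a.e. zero there is ρ₀ > 0
such that for 0 < ρ < ρ₀, all large N, some δ > 0 and every δ-near-minimiser Ψ: at the level K with
ρ^{-1/3} ≤ s_K = L/2^K < 2ρ^{-1/3} (it exists once N ≥ 1), occ_K(Ψ) ≥ N/2. Intended proof: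
Poincaré–Wirtinger in each cube, Σ_C (N_C − n_C) ≤ (s_K²/π²)·⟨Ψ, TΨ⟩ ≤ (4ρ^{-2/3}/π²)(E₀ + δ) and a
Dirichlet upper bound E₀ ≤ 4πρaN(1 + o(1)) + o(ρ^{2/3}N) give a deficit ≤ (16/π)(ρa³)^{1/3}N(1 +
o(1)) ≤ N/2. [difficulty: M] (why it might fail: Needs a DIRICHLET-box upper bound E₀ ≤ CρaN valid
for hard cores (Dyson/LSSY trial state with wall layer; only the periodic bound is in the tree) with
(4/π²)·4C(ρa³)^{1/3}-type constant < 1/2, and E₀ < ⊤; a v with E₀ = ⊤ at every (N, L) would make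
near-minimisers arbitrary.) [LSSY2005, arXiv:2510.20493, LiebYngvason1998, Dyson1957]
#5 HierCondensation (crux) — THE RUNG THEOREM (card THEOREM-CANDIDATE HierBEC, hard-core form; =
retired stmt-AtomisticToContinuum-6188 verbatim): for b ≥ 2, 0 < q < 1, q b² > 1 there is ν₀ > 0
such that for every filling floor ν₁ ≤ ν₀ there is c > 0 with, for all depths M and all N in the
window, every sector-N ground state v of the hierarchical hard-core gas has b^{-M} Re⟨v, (Σ_{x,y}
a†_x a_y) v⟩ ≥ cN⟨v, v⟩ — thermodynamic-limit BEC THROUGH A CLOSING GAP (gap q^M = |Λ|^{-2/d_s}).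
Follows from SiblingCoherence + CoherenceTelescoping + LevelOneDicke; a direct proof by another
engine (Tóth's interchange process on the hierarchy, a Bleher–Major recursion on block generating
functions) is equally welcome. [deps: SiblingCoherence] [difficulty: L] (why it might fail: for 1 <
d_s ≤ 2 (b⁻² < q ≤ b⁻¹) the dilute limit is strongly coupled (c(ν₁) → 0 as ν₁ → 0, Tonks-like), so
any proof uniform in the window must be non-perturbative at the ~log_b(1/ν₁) lowest populated
levels; commensurate supersite lobes bound ν₀(b, q) above.) [Penrose1991, Toth1990, Kirson2000,
BruDorlas2003, BleherMajor1989, Dyson1969]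
#9 FreeGasZeroMode (support) — FREE-GAS CASE (= stmt-AtomisticToContinuum-8912 verbatim, shared with
BECStoquasticCensoring / BECInfraredBound): for v a.e. zero on (0,∞) the interaction vanishes a.e.,
E₀ = 3Nπ²/L², gap 3π²/L², near-minimisers are close to χ^{⊗N} with χ = Π(2/L)^{1/2}sin(πx_j/L), and
⟨φ₀, γφ₀⟩ ≥ N/4 ((8/π²)³ ≈ 0.533). Needed because block-constant retention is FALSE for the sine
profile: (‖P_quarters χ‖², ‖P_halves χ‖²) = (0.9496³, 0.8106³) = (0.856, 0.533), a loss of 0.32N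
between levels 2 and 1 against a budget O(N^{2/3}). [difficulty: M] [LSSY2005]
#9 ContinuumTelescoping (support) — DYADIC TELESCOPING (provable now; finite sums, monotonicity of
occ_m under refinement is not even needed): GeometricRetention → WindowCondensation →
FreeGasZeroMode → X_B1, with the FreeGasZeroMode hypothesis inlined verbatim (stmt-8912 is a
pre-existing shared item whose position in the rendered file is not ours to choose; `closes` feeds
it the named item by definitional unfolding). Proof: split on v a.e. zero (FreeGasZeroMode);
otherwise take ρ₀ = min of the two thresholds, intersect the eventually-in-N sets with {N ≥ 1}, δ =
min(δ_R, δ_W); pick K with ρ^{-1/3} ≤ L/2^K < 2ρ^{-1/3} (L/ρ^{-1/3} = N^{1/3} ≥ 1); iterate the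
retention inequality for m = K−1, …, 0 (each child side ≥ s_K ≥ ρ^{-1/3}): occ_K ≤ occ_0 +
(1/8)Σ_{j≥0}2^{-j}(ρ^{-1/3}/s_K)N ≤ occ_0 + N/4, so occ_0 ≥ N/4; finally the level-0 cube {x | x_i ∈
(0·L/1, 1·L/1)} is box L with normalisation (√((L/1)³))⁻¹ = (√(L³))⁻¹, i.e. occ_0 is X_B1's
occupation, c = 1/4. [difficulty: provable-now] [LSSY2005, PenroseOnsager1956]
#9 PoincareCascade (support) — THE POINCARÉ CASCADE (provable now; the continuum ↔ hierarchical
dictionary, Literature-grade): for every N, M, L > 0 and every Dirichlet trial state Ψ, Σ_{m<M}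
w_m·occ_{m+1}(Ψ) ≤ Σ_{m<M} w_m·occ_m(Ψ) + ⟨Ψ, TΨ⟩ with w_m = π²/(4(m+1)²s_m²), s_m = L/2^m: the
Dirichlet kinetic energy dominates the hierarchical (Haar) kinetic energy Σ_m w_m (P_{m+1} − P_m) on
block-constant modes. Proof: Neumann Poincaré–Wirtinger on a cube of side s (constant π²/s²) gives
‖∇f‖²_P ≥ (π²/s²)Σ_{C⊂P}|C||f_C − f_P|²; spend a fraction ε_m of the remaining kinetic energy at
level m with ε_m·Π_{j<m}(1−ε_j) = (π²/4)/(π²(m+1)²) (feasible since Σ 1/(4(m+1)²) = π²/24 < 1),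
recurse into the children, lift to N bodies particle by particle and use Bose symmetry (Σ_i ⟨P⟩_i =
occ). KNOWN-TYPE technology (a variant of the kinetic localisations LSSY2005 Lemma 4.1,
arXiv:2510.20493 eq. (3), Junge2026 Thm 1/3 — weaker in that it sacrifices kinetic fractions, which
Junge avoids, but an all-levels-at-once inequality with explicit polylog weights); filed because it
is the exact continuum ↔ laboratory dictionary (T ≥ T_hier) and the engine foreseen for the
sub-healing levels of GeometricRetention. [difficulty: provable-now] [LSSY2005, arXiv:2510.20493,
Junge2026, doi:10.1090/S0025-5718-1990-1023042-6, GawedzkiKupiainen1985]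
#9 CoherenceTelescoping (support) — HIERARCHICAL TELESCOPING (= retired stmt-6189 verbatim; provable
now): for ANY vector v and any ε : ℕ → ℝ, per-level sibling coherence Re⟨A_B†A_B′⟩ ≥ (1 −
ε_ℓ)·½(⟨A_B†A_B⟩ + ⟨A_B′†A_B′⟩) (and ≥ 0) at every level implies ⟨Σ_x a†_x a_x⟩·Π_ℓ max(1/b, 1 − (1
− 1/b)ε_ℓ) ≤ b^{-M}⟨Σ_{x,y} a†_x a_y⟩ (A_parent = Σ_children A_B exactly). Glue of SiblingCoherence
→ HierCondensation. [difficulty: provable-now] [Leggett2001, PenroseOnsager1956]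
#9 LevelOneDicke (support) — LEVEL ONE = COMPLETE GRAPH K_b (= retired stmt-6190 verbatim; provable
now): for M = 1, H = q(N̂ − b⁻¹S⁺_tot S⁻_tot), so every sector-N Rayleigh minimiser (N ≤ b) is a
Dicke state and ⟨v, Σ_{x,y} a†_x a_y v⟩ = N(b − N + 1)⟨v, v⟩ exactly (condensate fraction (b − N +
1)/b, gap q). [difficulty: provable-now] [Penrose1991, Toth1990, Kirson2000]
#9 CasimirConservation (support) — EXACTNESS OF THE RECURSION (= retired stmt-6191 verbatim;
provable now; the audits' cheap test (b)): the level-ℓ block hopping form S⁺_B S⁻_B commutes with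
the total-spin Casimir of every block of level ℓ′ ≤ ℓ (blocks nested or disjoint; S⁺_B S⁻_B = S_B² −
(S³_B)² + S³_B), so every level-n term of H conserves all lower-level block Casimirs: sub-blocks
enter only through their total spins. [difficulty: provable-now] [Penrose1991, Tasaki2020]
#9 NoCondensationBelowThreshold (support) — THE DIAL, NEGATIVE SIDE (card H2; = retired stmt-6187
verbatim; filed as support so it does not key staffing, but it is the built-in refutation harness of
the mechanism): for q b² < 1 (d_s < 1) the zero-mode fraction of the sector ground state tends to 0
at every filling floor (E_C/E_J grows like (qb²)^{-ℓ}: sibling phases at the top levels are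
quantum-disordered rotors). [difficulty: L] [MaghrebiGongGorshkov2017, Dyson1969, Leggett2001,
PitaevskiiStringari1991]

TWO-LAYER PLAN. GeometricRetention ⇐ RetentionBelowHealing (levels with ρ^{-1/3} ≤ s ≤ Kξ: energy +
PoincareCascade, the multilevel form of LSSY
Lemma 4.1/Thm 5.1 — provable-looking, budget spent ≍ (ρa³)^{1/6}) → RetentionAboveHealing (s ≥ Kξ:
the Josephson half; induction
hypothesis per level = (block condensate fraction, block charging bound E(N_C+1) − 2E(N_C) +
E(N_C−1) ≲ 1/(χ|C|), relative-mode
occupation ≤ C√(E_C/E_J)·N_C), exactly the hypothesis SiblingCoherence propagates in the laboratory)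
→ GeometricRetention (glue:
split the level range). SiblingCoherence ⇐ ChargingBound (sector energies convex with E″ ≤ C b^{-ℓ}
in the window, by zero-mode
insertion/removal) → JosephsonStiffness (relative-phase twist of one child costs ≥ c q^{ℓ+1} f ρ b^ℓ
θ²) → SiblingCoherence (two-mode
virial inequality ⟨A*[H,A]⟩ ≥ 0 for relative number / current). WindowCondensation ⇐
DirichletUpperBound (E₀ ≤ 4πρaN(1+o(1)) +
O(N^{2/3}ρ^{2/3}) with hard cores) → CubePoincare (Σ_C(N_C − n_C) ≤ s²T/π²) → WindowCondensation.
Nothing here is filed now.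

KILL CRITERIA. ¬GeometricRetention for some genuinely interacting admissible v at arbitrarily small
ρ (a proof that octant relative-mode occupation
of near-minimisers is ≥ cN^{2/3+ε}, or that the per-level loss is not geometric above ρ^{-1/3})
closes the route
`refuted:GeometricRetention` unless the witness only beats the constant 1/8 or the inverse-linear
rate — then restate once with a free
summable budget β_m (Σβ ≤ 1/4) and record the witness; a second refutation closes.
¬WindowCondensation can only be a constant/E₀ = ⊤
pathology: restate with window factor 1/4·ρ^{-1/3} or an explicit E₀ < ⊤ guard. ¬SiblingCoherence in
EVERY filling window (ED/QMC on
the b = 8 hierarchy showing non-decaying sibling deficits for q b² ≥ 4, or a gapped incoherent phase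
at all small fillings) kills
the laboratory: the continuum spine survives formally but the route loses its engine — close
`refuted:SiblingCoherence` unless
HierCondensation is proved directly. ¬HierCondensation retires the card (mechanism = artefact). X_B1
or BoseEinsteinCondensation
proved elsewhere moots the continuum spine (close `superseded`, keep the laboratory items as
Literature-grade targets).

NOT DECOMPOSED YET. The level-range split of GeometricRetention and its induction hypothesis
(above); the Dirichlet upper bound with hard cores and the
cube Poincaré lemma behind WindowCondensation; monotonicity occ_m ≤ occ_{m+1} and the L²-Lipschitz
dependence of occ_m on Ψ
(near-minimiser ⇒ ground state at fixed N); the charging/stiffness children of SiblingCoherence;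
Perron–Frobenius uniqueness of
sector ground states (a `--supports` lemma); the sharp rates (θ = (qb²)^{-1/2} in the laboratory,
√(ρa³)(ξ/s)² log in the
continuum) — only the inverse-linear envelope is filed; the marginal dial q b² = 1; soft cores; any
hierarchical → Euclidean transfer
(none exists: T_hier ≤ T is one-sided and condensation is not monotone under operator inequalities —
KineticGapLengthScales).

CHEAPEST FALSIFIER. (i) Done here, by hand: the free Dirichlet gas violates block-constant retention
(loss 0.32N from level 2 to level 1; level 1 → 0
loses nothing by the symmetry of sin about L/2) — hence the `¬ a.e. zero` guard and FreeGasZeroMode;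
a refuter should first check
that no admissible INTERACTING v keeps a curved bulk profile as N → ∞ at fixed ρ (it does not: GP
bulk is flat beyond the wall
layer ξ = (8πρa)^{-1/2}, wall loss per level ≍ Nξ²/(Ls_{m+1}) ≪ budget (1/8)(ρ^{-1/3}/s_{m+1})N once
L ≫ ξ²ρ^{1/3}). (ii) Analytic,
cheap: insert the Bogoliubov momentum distribution of the periodic gas into occ_{m+1} − occ_m (Haar
weights sinc-type) and compare
with (1/8)(ρ^{-1/3}/s)N level by level — predicted ratio ≲ (ρa³)^{1/3} log at s ≍ ξ, N^{-1/3} at the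
top. (iii) The laboratory:
gen-1's pure-Python Lanczos (b = 4, M = 2, N = 4) already shows the dial (top sibling deficit
0.14/0.22/0.66/0.91 and n₀/N =
0.79/0.76/0.49/0.32 for q b² = 14.4/8/2.4/0.8); the real test is sign-free SSE/worm QMC on b = 8, M
= 3–4 (≤ 4096 sites) or DMRG on
the b = 2 chain, M = 8–9: flat sibling deficits over three perturbative levels at q b² ≥ 4 kill
SiblingCoherence. (iv) Ten lines
of algebra: CasimirConservation.

NUMBERS. Window: ℓ = ρ^{-1/3}; level K with s_K ∈ [ℓ, 2ℓ) exists iff N ≥ 1 (L/ℓ = N^{1/3}). Budget: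
Σ_m (1/8)(ℓ/s_{m+1}) ≤ (1/8)·2 = 1/4;
window constant 1/2 ⇒ X_B1 with c = 1/4. Crude window deficit: (s_K²/π²)(E₀+δ)/N ≤
(4ρ^{-2/3}/π²)·4πρa(1+o(1)) = (16/π)(ρa³)^{1/3}(1+o(1)), so
ρa³ ≤ (π/32)³ ≈ 9.5·10⁻⁴ suffices at leading order. Scales: a ≪ ρ^{-1/3} ≪ ξ = (8πρa)^{-1/2} ≪ L,
ratios (ρa³)^{1/3},
√(8π)(ρa³)^{1/6}. Heuristic per-level loss/N: bulk above ξ ≍ (8π)^{3/2}√(ρa³)(ξ/s)² log(s/ξ)/(2π²);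
below ξ ≍ Cρa²s (worst at s ≍ ξ:
≍ √(ρa³)); wall ≍ 3c₁²ξ²/(Ls); free-gas sine profile: ‖P_mχ‖² = 0.533, 0.533, 0.856 for m = 0, 1, 2
(1-D factors 8/π² = 0.8106,
0.8106, 0.9496). Top level: Bogoliubov relative-mode occupation ≍ 7·L/ξ ∝ N^{1/3} against budget
(1/4)ρ^{2/3}L² ∝ N^{2/3}.
Cascade weights: c/((m+1)²s_m²) feasible for c ≤ 6 (Σ1/(m+1)² = π²/6); filed c = π²/4. Laboratory
dictionary: block size b^n,
coupling q^n, d_s = 2 ln b/ln(1/q), physical point b = 8, q = 1/4 (d_s = 3, θ = 1/4 = inverse-square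
per level); continuum envelope
filed: inverse-linear (ratio 1/2 per level). E_C^{(n)} ≈ 2q/((1−q)b^n), E_J^{(n)} ≈ q^n
fρ(1−ρ)b^{n−1}, r_n ≈ 2(qb²)^{-(n−1)}/((1−q)fρ(1−ρ)).
Energy-currency reach (Junge2026 (25)–(26), Remark 5/7): strong estimate Tr n₊ ≤ CN(ρa³)^{1/2−η} at
L = a(ρa³)^{-1/2−η}, weak estimate ≤ CNρR²a(ρa³)^{1/2+η} on side R, η = 1/32 at T = 0, i.e. κ ≤
(2+2η)/(5+3η) ≈ 0.41 < 2/3. Mott-lobe caveat: U/(zJ) = 2/((b−1)q) > 5.83 ⇔ q(b−1) < 0.343. Items at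
open: 13 (4 cruxes, 1 target, 7 support, 1 assembly).

DEFINITION REQUESTS. None needed: occupation / TrialState / energy / groundStateEnergy / sideLength
/ box / kineticDensity
(Literature.MathematicalPhysics.QuantumManyBody.BoseGas) and Op / onSite / spinRaise / spinLower /
siteSpin
(Literature.MathematicalPhysics.QuantumLattice) exist; dyadic cubes and block-constant modes are
inlined (`let occ := …`).
Nice-to-have later: `blockOccupation (N) (L) (m) (Ψ)` under
Summits/AtomisticToContinuum/BoseEinsteinCondensation/Theorems so the
three continuum items shrink, and `hierarchicalHardCoreGas (M b) (q)` under
Literature/MathematicalPhysics/QuantumLattice.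

Novelty: Searches (2026-08-15, this seat): `lit galaxy search --star all` ×9 — "hierarchical Bose" (0),
"hierarchical XY model" (0),
"multilevel Poincare" (0), "Josephson coupling between blocks" (0), "coarse-grained density matrix
condensate" (0), "off-diagonal
long-range order renormalization" (0), "hierarchical Laplacian Bose Einstein condensation" (0),
"Dyson hierarchical" (6: von
Soosten–Warzel arXiv:1705.04884 hierarchical operators, Huang–Wang–Zeng arXiv:2512.02766 H^{2|2} on
the hierarchical lattice,
Hutchcroft arXiv:2508.18807, Angelini–Biroli arXiv:1702.03092 — no bosons), "hierarchical model"
(noise); `lit search` (searchd)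
was unavailable for the whole seat (D-0023 off-box service timing out; retried ×4), so the remote
cascade of gen-1 is carried:
zbMATH "Dyson hierarchical quantum spin" (8: Moreira–Schor doi:10.1007/bf02103277, Monthus
arXiv:1506.06012,
Albeverio–Kondratiev–Kozitsky), "hierarchical model quantum" (40; Benfatto–Gallavotti–Jauslin
arXiv:1506.04381 hierarchical Kondo =
closest methodological kin), "hierarchical XY model quantum rotor ground state long-range order"
(0), crossref "Bose-Einstein
condensation hierarchical lattice interacting bosons" (25, none hierarchical; Kirson2000), five
refuter audits (AUDIT-8/14/29/32/37:
Bleher–Major doi:10.1007/bf01210834, doi:10.1007/bf01217768 closest classical precedent; Bovier 1990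
/ Kritchevski free or
one-body hierarchical operators); `lit frontier AtomisticToContinuum --since 2023` (30 rows; read:
Junge2026 = arXiv  [refs: 10.1007/bf02103277, 10.1007/bf01210834, 10.1007/bf01217768, 1705.04884, 2512.02766, 2508.18807, 1702.03092, 1506.06012, 1506.04381, 2603.20776, 2510.20493, doi:10.1007/bf02103277, doi:10.1007/bf01210834, doi:10.1007/bf01217768, Kirson2000, Junge2026, BleherMajor1989, Penrose1991, Toth1990]

Barriers (technique_class: hierarchical-model real-space-rg josephson-blocks haar-loss): - technique_class: hierarchical-model real-space-rg josephson-blocks haar-loss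
- Literature.Barriers.AtomisticToContinuum.KineticGapLengthScales: used exactly where it is a
theorem and far inside its range — WindowCondensation sits at s ≍ ρ^{-1/3} ≪ ρ^{-1/3}Y^{-1/17}
(deficit (16/π)(ρa³)^{1/3}); above the window the route does NOT multiply (block side)² × excess
energy: GeometricRetention is a statement about occupations, paid per level by a geometric budget,
and the honest concession is that no engine for it beyond R ≍ a(ρa³)^{-3/4−η} is in print (Junge2026
Cor 6, arXiv:2510.20493 push the kinetic-gap reach there, still paying ∝ R²;
KineticGapLengthScalesNarrow: energy windows certify ≤ N/(M+1) — the crux is stated for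
near-minimisers with δ(N) free, i.e. for ground states).
- Literature.Barriers.AtomisticToContinuum.BogoliubovPerturbationInfrared: no expansion around a
Bogoliubov state anywhere; Bogoliubov theory enters only as the heuristic SIZE of the per-level loss
(slack (ρa³)^{1/3}) and, in the laboratory, for finite gapped level problems.
- Literature.Barriers.AtomisticToContinuum.EnergyAsymptoticsWithoutCondensation: WindowCondensation
needs only the leading-order upper bound at a sub-healing scale; GeometricRetention is not an
energy-asymptotics statement (it is false for the free gas, whose energy asymptotics are trivial,
and guarded accordingly).
- Literature.Barriers.AtomisticToContinuum.HalfFillingReflectionPositivity: not used — Dirichlet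
continuum at any small

History (route lifecycle, newest last):
- 2026-08-16T03:05:15Z · rev 2: restated ContinuumTelescoping (stmt-AtomisticToContinuum-14786) — route-choice (target-unreachable, operator hold 2026-08-16T02:49Z), option (a): restate the support glue ContinuumTelescoping 1:1 so that it CONCLUDES THE RANK- (planner-rchoice-AtomisticToContinuum-BECHierar-6776cb49-0)
- 2026-08-25T13:21:27Z · DORMANT — reconciler: no traction for 7.7 d (last activity item-evidence-added at 2026-08-17T19:15:47Z); parked, not closed — `ledger route dormant route-AtomisticToConti (operator:999:1691274)

sub-problem: BoseEinsteinCondensation · status: dormant · opened planner-plancard-AtomisticToContinuum-BoseEin-0a6d29ed-g2-0 2026-08-15T19:12:13Z · rev 2 · ledger route-AtomisticToContinuum-BECHierarchicalRetention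
GENERATED by the gate from the ledger (D-0016/17). Provers cite these decls: `theorem foo : Summit.AtomisticToContinuum.BoseEinsteinCondensation.Theses.BECHierarchicalRetention.<Decl> := …` in Summits/AtomisticToContinuum/BoseEinsteinCondensation/Theorems/<Name>.lean.
-/

namespace Summit.AtomisticToContinuum.BoseEinsteinCondensation.Theses.BECHierarchicalRetention

open scoped BigOperators Topology Manifold Classical MeasureTheory ProbabilityTheory Matrix InnerProductSpace ComplexConjugate ContinuousMap
open Filter Set Function TopologicalSpace MeasureTheory

attribute [summit_statement] _root_.BoseEinsteinCondensation

/-- item stmt-AtomisticToContinuum-0686 · target · rank 0 · open · by planner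
why it might fail: it is thermodynamic-limit BEC in zero-mode Dirichlet form (LSSY2005 Ch. 5, open); fails only if near-minimisers condense into a mode asymptotically orthogonal to φ₀, against the flat Gross–Pitaevskii bulk profile.
sources: LSSY2005, PenroseOnsager1956, Fournais2020, Junge2026
X_B1: zero-mode macroscopic occupation. For every repulsive finite-range v, at all small densities
ρ, for all large N there is δ > 0 such that every δ-near-minimiser Ψ of the Dirichlet N-body energy
in the box of side (N/ρ)^{1/3} has ⟨φ₀, γ_Ψ φ₀⟩ ≥ cN for the normalised constant mode φ₀ =
L^{-3/2}·1_box (c > 0 depending on v, ρ). -/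
@[route_item "route-AtomisticToContinuum-BECHierarchicalRetention"]
def ZeroModeOccupation : Prop :=
  ∀ v : ℝ → ENNReal, Literature.MathematicalPhysics.QuantumManyBody.BoseGas.IsRepulsiveFiniteRange v → ∃ ρ₀ : ℝ, 0 < ρ₀ ∧ ∀ ρ : ℝ, 0 < ρ → ρ < ρ₀ → ∃ c : ℝ, 0 < c ∧ ∀ᶠ N : ℕ in Filter.atTop, ∃ δ : ENNReal, 0 < δ ∧ ∀ Ψ : Literature.MathematicalPhysics.QuantumManyBody.BoseGas.TrialState N (Literature.MathematicalPhysics.QuantumManyBody.BoseGas.sideLength ρ N), Literature.MathematicalPhysics.QuantumManyBody.BoseGas.energy v Ψ ≤ Literature.MathematicalPhysics.QuantumManyBody.BoseGas.groundStateEnergy v N (Literature.MathematicalPhysics.QuantumManyBody.BoseGas.sideLength ρ N) + δ → ENNReal.ofReal (c * N) ≤ Literature.MathematicalPhysics.QuantumManyBody.BoseGas.occupation N ((Literature.MathematicalPhysics.QuantumManyBody.BoseGas.box (Literature.MathematicalPhysics.QuantumManyBody.BoseGas.sideLength ρ N)).indicator fun _ => ((Real.sqrt (Literature.MathematicalPhysics.QuantumManyBody.BoseGas.sideLength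 ρ N ^ 3))⁻¹ : ℂ)) Ψ.ψ

/-- item stmt-AtomisticToContinuum-14782 · crux · rank 2 · open · by planner
why it might fail: At the top level it asserts octant relative-mode occupation ≤ N^{2/3}/4 uniformly in N — the thermodynamic difficulty itself; energetic engines (Junge2026 Cor 6, arXiv:2510.20493) pay ∝ s² per step and stop at a(ρa³)^{-3/4}; an infrared anomaly beyond Bogoliubov (n_k ≫ 1/(kξ)) would break the law.
sources: Leggett2001, LSSY2005, Junge2026, arXiv:2510.20493, Fournais2020, BleherMajor1989
[crux] GEOMETRIC RETENTION OF BLOCK-CONSTANT OCCUPATION (continuum face of card H1). For every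
repulsive finite-range v that is not a.e. zero on (0,∞) there is ρ₀ > 0 such that for 0 < ρ < ρ₀,
for all large N, some δ > 0 and every δ-near-minimiser Ψ of the Dirichlet energy in the box of side
L = (N/ρ)^{1/3}: at every dyadic level m whose child cubes have side s_{m+1} = L/2^{m+1} ≥ ρ^{-1/3},
occ_{m+1}(Ψ) ≤ occ_m(Ψ) + (1/8)(ρ^{-1/3}/s_{m+1})·N, where occ_m = Σ over the 8^m level-m cubes C of
⟨φ_C, γ_Ψ φ_C⟩, φ_C = s_m^{-3/2}1_C. The increment is the occupation of the 7·8^m sibling relative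
modes (Haar details) at scale s_{m+1}; Bogoliubov + GP-wall heuristics give loss/N ≍ √(ρa³)(ξ/s)²
log(s/ξ) in the bulk above the healing length ξ, ≍ ρa²s below it, and ≍ ξ²/(Ls) from the Dirichlet
wall layer — all inside the inverse-linear budget once ρ^{-1/3} ≫ a, with slack (ρa³)^{1/3} at s ≍ ξ
and N^{1/3} at the octant level. Summed over levels the budget is ≤ N/4. [difficulty: open-problem] -/
@[route_item "route-AtomisticToContinuum-BECHierarchicalRetention", crux]
def GeometricRetention : Prop :=
  ∀ v : ℝ → ENNReal, Literature.MathematicalPhysics.QuantumManyBody.BoseGas.IsRepulsiveFiniteRange v → ¬ (∀ᵐ r ∂(MeasureTheory.volume.restrict (Set.Ioi (0 : ℝ))), v r = 0) → ∃ ρ₀ : ℝ, 0 < ρ₀ ∧ ∀ ρ : ℝ, 0 < ρ → ρ < ρ₀ → ∀ᶠ N : ℕ in Filter.atTop, ∃ δ : ENNReal, 0 < δ ∧ ∀ Ψ : Literature.MathematicalPhysics.QuantumManyBody.BoseGas.TrialState N (Literature.MathematicalPhysics.QuantumManyBody.BoseGas.sideLength ρ N), Literature.MathematicalPhysics.QuantumManyBody.BoseGas.energy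 v Ψ ≤ Literature.MathematicalPhysics.QuantumManyBody.BoseGas.groundStateEnergy v N (Literature.MathematicalPhysics.QuantumManyBody.BoseGas.sideLength ρ N) + δ → let L : ℝ := Literature.MathematicalPhysics.QuantumManyBody.BoseGas.sideLength ρ N; let occ : ℕ → ENNReal := fun m => ∑ k : Fin 3 → Fin (2 ^ m), Literature.MathematicalPhysics.QuantumManyBody.BoseGas.occupation N ({x : EuclideanSpace ℝ (Fin 3) | ∀ i, x i ∈ Set.Ioo (((k i : ℕ) : ℝ) * (L / 2 ^ m)) ((((k i : ℕ) : ℝ) + 1) * (L / 2 ^ m))}.indicator fun _ => ((Real.sqrt ((L / 2 ^ m) ^ 3))⁻¹ : ℂ)) Ψ.ψ; ∀ m : ℕ, ρ ^ (-(1 / 3 : ℝ)) ≤ L / 2 ^ (m + 1) → occ (m + 1) ≤ occ m + ENNReal.ofReal ((1 / 8) * (ρ ^ (-(1 / 3 : ℝ)) / (L / 2 ^ (m + 1))) * N)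

/-- item stmt-AtomisticToContinuum-14783 · crux · rank 3 · open · by planner
why it might fail: level-1 blocks are supersites with U_eff = 2q/b, hopping q²/b: mean-field Mott lobes at fillings k/b when q(b−1) ≲ 0.34 (inside q b² > 1 for q < 0.049, b = 8); if incoherent low levels feed E_J ∝ f_ℓ → 0 upward, no window ν₀ works.
sources: Leggett2001, FisherEtAl1989, Penrose1991, BleherMajor1984, MaghrebiGongGorshkov2017
[crux] LABORATORY TWIN OF RANK 2 (card H1 typed; = retired stmt-AtomisticToContinuum-6186 verbatim):
in the hard-core Bose gas on the b-adic hierarchy Λ_M = (Fin M → Fin b) with Dyson-hierarchical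
hopping H = Σ_n q^n Σ_{x∼_n y}(δ_xy − b^{-n}) a†_x a_y (one-body spectrum q^n, NO uniform gap, d_s =
2 ln b/ln(1/q); b = 8, q = 1/4 is the dyadic d_s = 3 point), for q b² > 1 there is a filling window
ν₁b^M ≤ N ≤ ν₀b^M in which every sector ground state has, at every level ℓ and for every pair of
sibling blocks B ≠ B′, Re⟨A_B†A_B′⟩ ≥ 0 and Re⟨A_B†A_B′⟩ ≥ (1 − Cθ^{ℓ+1})·½(⟨A_B†A_B⟩ + ⟨A_B′†A_B′⟩)
with θ < 1 (predicted θ = (qb²)^{-1/2} = √(E_C/E_J) per level; big blocks MORE coherent). Here the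
level-n coupling sees sub-blocks only through (N_B′, a_B′) (CasimirConservation), level 1 is the
solved complete graph (LevelOneDicke), and the per-level step is a finite-dimensional gapped
problem: the one interacting model where the rank-2 law should be provable as stated. [difficulty:
L] -/
@[route_item "route-AtomisticToContinuum-BECHierarchicalRetention"]
def SiblingCoherence : Prop :=
  ∀ b : ℕ, 2 ≤ b → ∀ q : ℝ, 0 < q → q < 1 → 1 < q * (b : ℝ) ^ 2 → ∃ ν₀ : ℝ, 0 < ν₀ ∧ ∀ ν₁ : ℝ, 0 < ν₁ → ν₁ ≤ ν₀ → ∃ θ : ℝ, 0 ≤ θ ∧ θ < 1 ∧ ∃ C : ℝ, ∀ M : ℕ, 1 ≤ M → ∀ N : ℕ, ν₁ * (b : ℝ) ^ M ≤ (N : ℝ) → (N : ℝ) ≤ ν₀ * (b : ℝ) ^ M → ∀ (H : Literature.MathematicalPhysics.QuantumLattice.Op (Fin M → Fin b) 2) (A : ℕ → (Fin M → Fin b) → Literature.MathematicalPhysics.QuantumLattice.Op (Fin M → Fin b) 2), H = (∑ n : Fin M, ∑ x : Fin M → Fin b, ∑ y : Fin M → Fin b, (if (∀ i : Fin M, n.val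 < i.val → x i = y i) then ((q : ℂ) ^ (n.val + 1) * ((if x = y then (1 : ℂ) else 0) - ((b : ℂ) ^ (n.val + 1))⁻¹)) else 0) • (Literature.MathematicalPhysics.QuantumLattice.onSite x (Literature.MathematicalPhysics.QuantumLattice.spinRaise 1) * Literature.MathematicalPhysics.QuantumLattice.onSite y (Literature.MathematicalPhysics.QuantumLattice.spinLower 1))) → A = (fun (ℓ : ℕ) (z : Fin M → Fin b) => ∑ y : Fin M → Fin b, if (∀ i : Fin M, ℓ ≤ i.val → y i = z i) then Literature.MathematicalPhysics.QuantumLattice.onSite y (Literature.MathematicalPhysics.QuantumLattice.spinLower 1) else 0) → ∀ v : ((Fin M → Fin b) → Fin 2) → ℂ, (∀ σ : (Fin M → Fin b) → Fin 2, (Finset.univ.filter fun x => σ x = 0).card ≠ N → v σ = 0) → v ≠ 0 → (∀ w : ((Fin M → Fin b) → Fin 2) → ℂ, (∀ σ : (Fin M → Fin b) → Fin 2, (Finset.univ.filter fun x => σ x = 0).card ≠ N → w σ = 0) → (star v ⬝ᵥ H.mulVec v).re * (star w ⬝ᵥ w).re ≤ (star w ⬝ᵥ H.mulVec w).re * (star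 v ⬝ᵥ v).re) → ∀ ℓ : ℕ, ℓ < M → ∀ x x' : Fin M → Fin b, (∀ i : Fin M, ℓ + 1 ≤ i.val → x i = x' i) → ¬ (∀ i : Fin M, ℓ ≤ i.val → x i = x' i) → 0 ≤ (star v ⬝ᵥ ((A ℓ x)ᴴ * A ℓ x').mulVec v).re ∧ (1 - C * θ ^ (ℓ + 1)) * (((star v ⬝ᵥ ((A ℓ x)ᴴ * A ℓ x).mulVec v).re + (star v ⬝ᵥ ((A ℓ x')ᴴ * A ℓ x').mulVec v).re) / 2) ≤ (star v ⬝ᵥ ((A ℓ x)ᴴ * A ℓ x').mulVec v).re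

/-- item stmt-AtomisticToContinuum-14784 · crux · rank 4 · open · by planner
why it might fail: Needs a DIRICHLET-box upper bound E₀ ≤ CρaN valid for hard cores (Dyson/LSSY trial state with wall layer; only the periodic bound is in the tree) with (4/π²)·4C(ρa³)^{1/3}-type constant < 1/2, and E₀ < ⊤; a v with E₀ = ⊤ at every (N, L) would make near-minimisers arbitrary.
sources: LSSY2005, arXiv:2510.20493, LiebYngvason1998, Dyson1957
[crux] WINDOW CONDENSATION AT THE INTERPARTICLE SCALE (the kinetic gap used exactly where it is a
theorem). For every repulsive finite-range v not a.e. zero there is ρ₀ > 0 such that for 0 < ρ < ρ₀,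
all large N, some δ > 0 and every δ-near-minimiser Ψ: at the level K with ρ^{-1/3} ≤ s_K = L/2^K <
2ρ^{-1/3} (it exists once N ≥ 1), occ_K(Ψ) ≥ N/2. Intended proof: Poincaré–Wirtinger in each cube,
Σ_C (N_C − n_C) ≤ (s_K²/π²)·⟨Ψ, TΨ⟩ ≤ (4ρ^{-2/3}/π²)(E₀ + δ) and a Dirichlet upper bound E₀ ≤
4πρaN(1 + o(1)) + o(ρ^{2/3}N) give a deficit ≤ (16/π)(ρa³)^{1/3}N(1 + o(1)) ≤ N/2. [difficulty: M] -/
@[route_item "route-AtomisticToContinuum-BECHierarchicalRetention", crux]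
def WindowCondensation : Prop :=
  ∀ v : ℝ → ENNReal, Literature.MathematicalPhysics.QuantumManyBody.BoseGas.IsRepulsiveFiniteRange v → ¬ (∀ᵐ r ∂(MeasureTheory.volume.restrict (Set.Ioi (0 : ℝ))), v r = 0) → ∃ ρ₀ : ℝ, 0 < ρ₀ ∧ ∀ ρ : ℝ, 0 < ρ → ρ < ρ₀ → ∀ᶠ N : ℕ in Filter.atTop, ∃ δ : ENNReal, 0 < δ ∧ ∀ Ψ : Literature.MathematicalPhysics.QuantumManyBody.BoseGas.TrialState N (Literature.MathematicalPhysics.QuantumManyBody.BoseGas.sideLength ρ N), Literature.MathematicalPhysics.QuantumManyBody.BoseGas.energy v Ψ ≤ Literature.MathematicalPhysics.QuantumManyBody.BoseGas.groundStateEnergy v N (Literature.MathematicalPhysics.QuantumManyBody.BoseGas.sideLength ρ N) + δ → let L : ℝ := Literature.MathematicalPhysics.QuantumManyBody.BoseGas.sideLength ρ N; let occ : ℕ → ENNReal := fun m => ∑ k : Fin 3 → Fin (2 ^ m), Literature.MathematicalPhysics.QuantumManyBody.BoseGas.occupation N ({x : EuclideanSpace ℝ (Fin 3) | ∀ i, x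 i ∈ Set.Ioo (((k i : ℕ) : ℝ) * (L / 2 ^ m)) ((((k i : ℕ) : ℝ) + 1) * (L / 2 ^ m))}.indicator fun _ => ((Real.sqrt ((L / 2 ^ m) ^ 3))⁻¹ : ℂ)) Ψ.ψ; ∀ K : ℕ, ρ ^ (-(1 / 3 : ℝ)) ≤ L / 2 ^ K → L / 2 ^ K < 2 * ρ ^ (-(1 / 3 : ℝ)) → ENNReal.ofReal ((1 / 2) * N) ≤ occ K

/-- item stmt-AtomisticToContinuum-14785 · crux · rank 5 · open · by planner
why it might fail: for 1 < d_s ≤ 2 (b⁻² < q ≤ b⁻¹) the dilute limit is strongly coupled (c(ν₁) → 0 as ν₁ → 0, Tonks-like), so any proof uniform in the window must be non-perturbative at the ~log_b(1/ν₁) lowest populated levels; commensurate supersite lobes bound ν₀(b, q) above.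
sources: Penrose1991, Toth1990, Kirson2000, BruDorlas2003, BleherMajor1989, Dyson1969
[crux] THE RUNG THEOREM (card THEOREM-CANDIDATE HierBEC, hard-core form; = retired
stmt-AtomisticToContinuum-6188 verbatim): for b ≥ 2, 0 < q < 1, q b² > 1 there is ν₀ > 0 such that
for every filling floor ν₁ ≤ ν₀ there is c > 0 with, for all depths M and all N in the window, every
sector-N ground state v of the hierarchical hard-core gas has b^{-M} Re⟨v, (Σ_{x,y} a†_x a_y) v⟩ ≥
cN⟨v, v⟩ — thermodynamic-limit BEC THROUGH A CLOSING GAP (gap q^M = |Λ|^{-2/d_s}). Follows from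
SiblingCoherence + CoherenceTelescoping + LevelOneDicke; a direct proof by another engine (Tóth's
interchange process on the hierarchy, a Bleher–Major recursion on block generating functions) is
equally welcome. [deps: SiblingCoherence] [difficulty: L] -/
@[route_item "route-AtomisticToContinuum-BECHierarchicalRetention"]
def HierCondensation : Prop :=
  ∀ b : ℕ, 2 ≤ b → ∀ q : ℝ, 0 < q → q < 1 → 1 < q * (b : ℝ) ^ 2 → ∃ ν₀ : ℝ, 0 < ν₀ ∧ ∀ ν₁ : ℝ, 0 < ν₁ → ν₁ ≤ ν₀ → ∃ c : ℝ, 0 < c ∧ ∀ M : ℕ, 1 ≤ M → ∀ N : ℕ, ν₁ * (b : ℝ) ^ M ≤ (N : ℝ) → (N : ℝ) ≤ ν₀ * (b : ℝ) ^ M → ∀ (H P : Literature.MathematicalPhysics.QuantumLattice.Op (Fin M → Fin b) 2), H = (∑ n : Fin M, ∑ x : Fin M → Fin b, ∑ y : Fin M → Fin b, (if (∀ i : Fin M, n.val < i.val → x i = y i) then ((q : ℂ) ^ (n.val + 1) * ((if x = y then (1 : ℂ) else 0) - ((b : ℂ) ^ (n.val + 1))⁻¹)) else 0) • (Literature.MathematicalPhysics.QuantumLattice.onSite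 x (Literature.MathematicalPhysics.QuantumLattice.spinRaise 1) * Literature.MathematicalPhysics.QuantumLattice.onSite y (Literature.MathematicalPhysics.QuantumLattice.spinLower 1))) → P = (∑ x : Fin M → Fin b, ∑ y : Fin M → Fin b, Literature.MathematicalPhysics.QuantumLattice.onSite x (Literature.MathematicalPhysics.QuantumLattice.spinRaise 1) * Literature.MathematicalPhysics.QuantumLattice.onSite y (Literature.MathematicalPhysics.QuantumLattice.spinLower 1)) → ∀ v : ((Fin M → Fin b) → Fin 2) → ℂ, (∀ σ : (Fin M → Fin b) → Fin 2, (Finset.univ.filter fun x => σ x = 0).card ≠ N → v σ = 0) → v ≠ 0 → (∀ w : ((Fin M → Fin b) → Fin 2) → ℂ, (∀ σ : (Fin M → Fin b) → Fin 2, (Finset.univ.filter fun x => σ x = 0).card ≠ N → w σ = 0) → (star v ⬝ᵥ H.mulVec v).re * (star w ⬝ᵥ w).re ≤ (star w ⬝ᵥ H.mulVec w).re * (star v ⬝ᵥ v).re) → c * N * (star v ⬝ᵥ v).re ≤ ((b : ℝ) ^ M)⁻¹ * (star v ⬝ᵥ P.mulVec v).re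

-- earlier ContinuumTelescoping (stmt-AtomisticToContinuum-14786, replaced 2026-08-16T03:05:15Z -> stmt-AtomisticToContinuum-14156): retired by None — GeometricRetention → WindowCondensation → (∀ v : ℝ → ENNReal, Literature.MathematicalPhysics.QuantumManyBody.BoseGas.IsRepulsiveFiniteRange v → (∀ᵐ r ∂(MeasureTheory.volume.restrict (Set.Ioi (0 : ℝ))), v r = 0) → ∃ ρ₀ : ℝ, 0 < ρ₀ ∧ ∀ ρ : ℝ, 0 < ρ → ρ <
/-- item stmt-AtomisticToContinuum-14156 · support · rank 9 · open · by planner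
sources: LSSY2005, PenroseOnsager1956
[support] DYADIC TELESCOPING — the glue that concludes the rank-0 target BY NAME (route-choice
repair 2026-08-16, 1:1 restatement of the 2026-08-15 item, definitionally equal to it: `rfl` in the
planner's Sketch.lean): GeometricRetention → WindowCondensation → FreeGasZeroMode →
ZeroModeOccupation (X_B1 = stmt-AtomisticToContinuum-0686). The FreeGasZeroMode hypothesis is
inlined verbatim (the shared support stmt-8912 renders after this item in the gate-written file;
`closes` feeds it the named item by definitional unfolding); the conclusion is the named target
decl, which renders first. Provable now (finite sums; monotonicity of occ_m under refinement is not
even needed). Proof: split on v a.e. zero (then hypothesis 3 is the conclusion); otherwise take ρ₀ =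
min of the two thresholds, intersect the eventually-in-N sets with {N ≥ 1}, δ = min(δ_R, δ_W); pick
K with ρ^{-1/3} ≤ L/2^K < 2ρ^{-1/3} (L/ρ^{-1/3} = N^{1/3} ≥ 1); iterate the retention inequality for
m = K−1, …, 0 (each child side ≥ s_K ≥ ρ^{-1/3}): occ_K ≤ occ_0 + (1/8)Σ_{j≥0}2^{-j}(ρ^{-1/3}/s_K)N
≤ occ_0 + N/4, so occ_0 ≥ N/4; finally the level-0 cube {x | x_i ∈ (0·L/1, 1·L/1)} is box L with
normalisation (√((L/1)³))⁻¹ = (√(L³ -/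
@[route_item "route-AtomisticToContinuum-BECHierarchicalRetention", crux]
def ContinuumTelescoping : Prop :=
  GeometricRetention → WindowCondensation → (∀ v : ℝ → ENNReal, Literature.MathematicalPhysics.QuantumManyBody.BoseGas.IsRepulsiveFiniteRange v → (∀ᵐ r ∂(MeasureTheory.volume.restrict (Set.Ioi (0 : ℝ))), v r = 0) → ∃ ρ₀ : ℝ, 0 < ρ₀ ∧ ∀ ρ : ℝ, 0 < ρ → ρ < ρ₀ → ∃ c : ℝ, 0 < c ∧ ∀ᶠ N : ℕ in Filter.atTop, ∃ δ : ENNReal, 0 < δ ∧ ∀ Ψ : Literature.MathematicalPhysics.QuantumManyBody.BoseGas.TrialState N (Literature.MathematicalPhysics.QuantumManyBody.BoseGas.sideLength ρ N), Literature.MathematicalPhysics.QuantumManyBody.BoseGas.energy v Ψ ≤ Literature.MathematicalPhysics.QuantumManyBody.BoseGas.groundStateEnergy v N (Literature.MathematicalPhysics.QuantumManyBody.BoseGas.sideLength ρ N) + δ → ENNReal.ofReal (c * N) ≤ Literature.MathematicalPhysics.QuantumManyBody.BoseGas.occupation N ((Literature.MathematicalPhysics.QuantumManyBody.BoseGas.box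 (Literature.MathematicalPhysics.QuantumManyBody.BoseGas.sideLength ρ N)).indicator fun _ => ((Real.sqrt (Literature.MathematicalPhysics.QuantumManyBody.BoseGas.sideLength ρ N ^ 3))⁻¹ : ℂ)) Ψ.ψ) → ZeroModeOccupation

/-- item stmt-AtomisticToContinuum-14787 · support · rank 9 · open · by planner
sources: LSSY2005, arXiv:2510.20493, Junge2026, doi:10.1090/S0025-5718-1990-1023042-6, GawedzkiKupiainen1985
[support] THE POINCARÉ CASCADE (provable now; the continuum ↔ hierarchical dictionary,
Literature-grade): for every N, M, L > 0 and every Dirichlet trial state Ψ, Σ_{m<M} w_m·occ_{m+1}(Ψ)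
≤ Σ_{m<M} w_m·occ_m(Ψ) + ⟨Ψ, TΨ⟩ with w_m = π²/(4(m+1)²s_m²), s_m = L/2^m: the Dirichlet kinetic
energy dominates the hierarchical (Haar) kinetic energy Σ_m w_m (P_{m+1} − P_m) on block-constant
modes. Proof: Neumann Poincaré–Wirtinger on a cube of side s (constant π²/s²) gives ‖∇f‖²_P ≥
(π²/s²)Σ_{C⊂P}|C||f_C − f_P|²; spend a fraction ε_m of the remaining kinetic energy at level m with
ε_m·Π_{j<m}(1−ε_j) = (π²/4)/(π²(m+1)²) (feasible since Σ 1/(4(m+1)²) = π²/24 < 1), recurse into the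
children, lift to N bodies particle by particle and use Bose symmetry (Σ_i ⟨P⟩_i = occ). KNOWN-TYPE
technology (a variant of the kinetic localisations LSSY2005 Lemma 4.1, arXiv:2510.20493 eq. (3),
Junge2026 Thm 1/3 — weaker in that it sacrifices kinetic fractions, which Junge avoids, but an
all-levels-at-once inequality with explicit polylog weights); filed because it is the exact
continuum ↔ laboratory dictionary (T ≥ T_hier) and the engine foreseen for the sub-healing levels of
GeometricRetention. [difficulty: prova -/
@[route_item "route-AtomisticToContinuum-BECHierarchicalRetention"]
def PoincareCascade : Prop :=
  ∀ (N M : ℕ) (L : ℝ), 0 < L → ∀ Ψ : Literature.MathematicalPhysics.QuantumManyBody.BoseGas.TrialState N L, let occ : ℕ → ENNReal := fun m => ∑ k : Fin 3 → Fin (2 ^ m), Literature.MathematicalPhysics.QuantumManyBody.BoseGas.occupation N ({x : EuclideanSpace ℝ (Fin 3) | ∀ i, x i ∈ Set.Ioo (((k i : ℕ) : ℝ) * (L / 2 ^ m)) ((((k i : ℕ) : ℝ) + 1) * (L / 2 ^ m))}.indicator fun _ => ((Real.sqrt ((L / 2 ^ m) ^ 3))⁻¹ : ℂ)) Ψ.ψ;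 ∑ m ∈ Finset.range M, ENNReal.ofReal (Real.pi ^ 2 / (4 * ((m : ℝ) + 1) ^ 2 * (L / 2 ^ m) ^ 2)) * occ (m + 1) ≤ (∑ m ∈ Finset.range M, ENNReal.ofReal (Real.pi ^ 2 / (4 * ((m : ℝ) + 1) ^ 2 * (L / 2 ^ m) ^ 2)) * occ m) + ∫⁻ X, Literature.MathematicalPhysics.QuantumManyBody.BoseGas.kineticDensity Ψ.ψ X

/-- item stmt-AtomisticToContinuum-14788 · support · rank 9 · open · by planner
sources: Leggett2001, PenroseOnsager1956
[support] HIERARCHICAL TELESCOPING (= retired stmt-6189 verbatim; provable now): for ANY vector v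
and any ε : ℕ → ℝ, per-level sibling coherence Re⟨A_B†A_B′⟩ ≥ (1 − ε_ℓ)·½(⟨A_B†A_B⟩ + ⟨A_B′†A_B′⟩)
(and ≥ 0) at every level implies ⟨Σ_x a†_x a_x⟩·Π_ℓ max(1/b, 1 − (1 − 1/b)ε_ℓ) ≤ b^{-M}⟨Σ_{x,y} a†_x
a_y⟩ (A_parent = Σ_children A_B exactly). Glue of SiblingCoherence → HierCondensation. [difficulty:
provable-now] -/
@[route_item "route-AtomisticToContinuum-BECHierarchicalRetention"]
def CoherenceTelescoping : Prop :=
  ∀ (M b : ℕ), 1 ≤ b → ∀ (ε : ℕ → ℝ) (A : ℕ → (Fin M → Fin b) → Literature.MathematicalPhysics.QuantumLattice.Op (Fin M → Fin b) 2), A = (fun (ℓ : ℕ) (z : Fin M → Fin b) => ∑ y : Fin M → Fin b, if (∀ i : Fin M, ℓ ≤ i.val → y i = z i) then Literature.MathematicalPhysics.QuantumLattice.onSite y (Literature.MathematicalPhysics.QuantumLattice.spinLower 1) else 0) → ∀ v : ((Fin M → Fin b) → Fin 2) → ℂ, (∀ ℓ : ℕ, ℓ < M → ∀ x x' : Fin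 M → Fin b, (∀ i : Fin M, ℓ + 1 ≤ i.val → x i = x' i) → ¬ (∀ i : Fin M, ℓ ≤ i.val → x i = x' i) → 0 ≤ (star v ⬝ᵥ ((A ℓ x)ᴴ * A ℓ x').mulVec v).re ∧ (1 - ε ℓ) * (((star v ⬝ᵥ ((A ℓ x)ᴴ * A ℓ x).mulVec v).re + (star v ⬝ᵥ ((A ℓ x')ᴴ * A ℓ x').mulVec v).re) / 2) ≤ (star v ⬝ᵥ ((A ℓ x)ᴴ * A ℓ x').mulVec v).re) → (star v ⬝ᵥ (∑ x : Fin M → Fin b, (A 0 x)ᴴ * A 0 x).mulVec v).re * ∏ ℓ ∈ Finset.range M, max ((b : ℝ)⁻¹) (1 - (1 - (b : ℝ)⁻¹) * ε ℓ) ≤ ((b : ℝ) ^ M)⁻¹ * (star v ⬝ᵥ (∑ x : Fin M → Fin b, ∑ y : Fin M → Fin b, (A 0 x)ᴴ * A 0 y).mulVec v).re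

/-- item stmt-AtomisticToContinuum-14789 · support · rank 9 · open · by planner
sources: Penrose1991, Toth1990, Kirson2000
[support] LEVEL ONE = COMPLETE GRAPH K_b (= retired stmt-6190 verbatim; provable now): for M = 1, H
= q(N̂ − b⁻¹S⁺_tot S⁻_tot), so every sector-N Rayleigh minimiser (N ≤ b) is a Dicke state and ⟨v,
Σ_{x,y} a†_x a_y v⟩ = N(b − N + 1)⟨v, v⟩ exactly (condensate fraction (b − N + 1)/b, gap q).
[difficulty: provable-now] -/
@[route_item "route-AtomisticToContinuum-BECHierarchicalRetention"]
def LevelOneDicke : Prop :=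
  ∀ b : ℕ, 1 ≤ b → ∀ q : ℝ, 0 < q → ∀ N : ℕ, N ≤ b → ∀ (H P : Literature.MathematicalPhysics.QuantumLattice.Op (Fin 1 → Fin b) 2), H = (∑ n : Fin 1, ∑ x : Fin 1 → Fin b, ∑ y : Fin 1 → Fin b, (if (∀ i : Fin 1, n.val < i.val → x i = y i) then ((q : ℂ) ^ (n.val + 1) * ((if x = y then (1 : ℂ) else 0) - ((b : ℂ) ^ (n.val + 1))⁻¹)) else 0) • (Literature.MathematicalPhysics.QuantumLattice.onSite x (Literature.MathematicalPhysics.QuantumLattice.spinRaise 1) * Literature.MathematicalPhysics.QuantumLattice.onSite y (Literature.MathematicalPhysics.QuantumLattice.spinLower 1))) → P = (∑ x : Fin 1 → Fin b, ∑ y : Fin 1 → Fin b, Literature.MathematicalPhysics.QuantumLattice.onSite x (Literature.MathematicalPhysics.QuantumLattice.spinRaise 1) * Literature.MathematicalPhysics.QuantumLattice.onSite y (Literature.MathematicalPhysics.QuantumLattice.spinLower 1)) → ∀ v : ((Fin 1 → Fin b) → Fin 2) → ℂ, (∀ σ : (Fin 1 → Fin b) → Fin 2, (Finset.univ.filter fun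 x => σ x = 0).card ≠ N → v σ = 0) → v ≠ 0 → (∀ w : ((Fin 1 → Fin b) → Fin 2) → ℂ, (∀ σ : (Fin 1 → Fin b) → Fin 2, (Finset.univ.filter fun x => σ x = 0).card ≠ N → w σ = 0) → (star v ⬝ᵥ H.mulVec v).re * (star w ⬝ᵥ w).re ≤ (star w ⬝ᵥ H.mulVec w).re * (star v ⬝ᵥ v).re) → (star v ⬝ᵥ P.mulVec v).re = (N : ℝ) * ((b : ℝ) - N + 1) * (star v ⬝ᵥ v).re

/-- item stmt-AtomisticToContinuum-14790 · support · rank 9 · open · by planner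
sources: Penrose1991, Tasaki2020
[support] EXACTNESS OF THE RECURSION (= retired stmt-6191 verbatim; provable now; the audits' cheap
test (b)): the level-ℓ block hopping form S⁺_B S⁻_B commutes with the total-spin Casimir of every
block of level ℓ′ ≤ ℓ (blocks nested or disjoint; S⁺_B S⁻_B = S_B² − (S³_B)² + S³_B), so every
level-n term of H conserves all lower-level block Casimirs: sub-blocks enter only through their
total spins. [difficulty: provable-now] -/
@[route_item "route-AtomisticToContinuum-BECHierarchicalRetention"]
def CasimirConservation : Prop :=
  ∀ (M b ℓ ℓ' : ℕ), ℓ' ≤ ℓ → ∀ x z : Fin M → Fin b, Commute (∑ y : Fin M → Fin b, ∑ y' : Fin M → Fin b, (if (∀ i : Fin M, ℓ ≤ i.val → y i = x i) ∧ (∀ i : Fin M, ℓ ≤ i.val → y' i = x i) then Literature.MathematicalPhysics.QuantumLattice.onSite y (Literature.MathematicalPhysics.QuantumLattice.spinRaise 1) * Literature.MathematicalPhysics.QuantumLattice.onSite y' (Literature.MathematicalPhysics.QuantumLattice.spinLower 1) else (0 : Literature.MathematicalPhysics.QuantumLattice.Op (Fin M → Fin b) 2))) (∑ α : Fin 3,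 (∑ w : Fin M → Fin b, (if (∀ i : Fin M, ℓ' ≤ i.val → w i = z i) then Literature.MathematicalPhysics.QuantumLattice.siteSpin 1 w α else (0 : Literature.MathematicalPhysics.QuantumLattice.Op (Fin M → Fin b) 2))) ^ 2)

/-- item stmt-AtomisticToContinuum-14791 · support · rank 9 · open · by planner
sources: MaghrebiGongGorshkov2017, Dyson1969, Leggett2001, PitaevskiiStringari1991
[support] THE DIAL, NEGATIVE SIDE (card H2; = retired stmt-6187 verbatim; filed as support so it
does not key staffing, but it is the built-in refutation harness of the mechanism): for q b² < 1
(d_s < 1) the zero-mode fraction of the sector ground state tends to 0 at every filling floor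
(E_C/E_J grows like (qb²)^{-ℓ}: sibling phases at the top levels are quantum-disordered rotors).
[difficulty: L] -/
@[route_item "route-AtomisticToContinuum-BECHierarchicalRetention"]
def NoCondensationBelowThreshold : Prop :=
  ∀ b : ℕ, 2 ≤ b → ∀ q : ℝ, 0 < q → q * (b : ℝ) ^ 2 < 1 → ∀ ν₁ : ℝ, 0 < ν₁ → ∀ c : ℝ, 0 < c → ∃ M₀ : ℕ, ∀ M : ℕ, M₀ ≤ M → ∀ N : ℕ, ν₁ * (b : ℝ) ^ M ≤ (N : ℝ) → ∀ (H P : Literature.MathematicalPhysics.QuantumLattice.Op (Fin M → Fin b) 2), H = (∑ n : Fin M, ∑ x : Fin M → Fin b, ∑ y : Fin M → Fin b, (if (∀ i : Fin M, n.val < i.val → x i = y i) then ((q : ℂ) ^ (n.val + 1) * ((if x = y then (1 : ℂ) else 0) - ((b : ℂ) ^ (n.val + 1))⁻¹)) else 0) • (Literature.MathematicalPhysics.QuantumLattice.onSite x (Literature.MathematicalPhysics.QuantumLattice.spinRaise 1) * Literature.MathematicalPhysics.QuantumLattice.onSite y (Literature.MathematicalPhysics.QuantumLattice.spinLower 1)))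 → P = (∑ x : Fin M → Fin b, ∑ y : Fin M → Fin b, Literature.MathematicalPhysics.QuantumLattice.onSite x (Literature.MathematicalPhysics.QuantumLattice.spinRaise 1) * Literature.MathematicalPhysics.QuantumLattice.onSite y (Literature.MathematicalPhysics.QuantumLattice.spinLower 1)) → ∀ v : ((Fin M → Fin b) → Fin 2) → ℂ, (∀ σ : (Fin M → Fin b) → Fin 2, (Finset.univ.filter fun x => σ x = 0).card ≠ N → v σ = 0) → v ≠ 0 → (∀ w : ((Fin M → Fin b) → Fin 2) → ℂ, (∀ σ : (Fin M → Fin b) → Fin 2, (Finset.univ.filter fun x => σ x = 0).card ≠ N → w σ = 0) → (star v ⬝ᵥ H.mulVec v).re * (star w ⬝ᵥ w).re ≤ (star w ⬝ᵥ H.mulVec w).re * (star v ⬝ᵥ v).re) → ((b : ℝ) ^ M)⁻¹ * (star v ⬝ᵥ P.mulVec v).re ≤ c * N * (star v ⬝ᵥ v).re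

/-- item stmt-AtomisticToContinuum-8912 · support · rank 9 · closed · proved by Summit.AtomisticToContinuum.BoseEinsteinCondensation.Theorems.BecFreeGas_proof @ 264277954012 (prover) · by planner
sources: LSSY2005
[support] FREE-GAS CASE (new; refuters g12-5/g28-0 knock-on): for every repulsive finite-range v
that IS a.e. zero on (0,∞) the interaction term vanishes a.e. on configuration space (pair-distance
level sets of a null set are null), so energy = kinetic: the free Dirichlet gas. Then X_B1 for v: E₀
= 3Nπ²/L² (sharp Poincaré on (0,L)), gap 3π²/L² to the first excited level, so a δ-near-minimiser
with δ ≤ η²·3π²/L² is L²-within η of e^(iα)χ^⊗N, χ = ∏_j (2/L)^(1/2) sin(πx_j/L);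
√occupation(φ₀,·)/√N is 1-Lipschitz in L², and occupation(φ₀, χ^⊗N) = N·|⟨L^(-3/2), χ⟩|² = (8/π²)³N
≈ 0.533N, whence ⟨φ₀,γ_Ψφ₀⟩ ≥ N/4 for η small: c = 1/4, any ρ₀. Provable now; Lean-heavy (1-D
Wirtinger/Poincaré with sharp constant, tensorisation, explicit sine integrals). [difficulty: M]
[sources: LSSY2005] -/
@[route_item "route-AtomisticToContinuum-BECHierarchicalRetention", crux]
def FreeGasZeroMode : Prop :=
  ∀ v : ℝ → ENNReal, Literature.MathematicalPhysics.QuantumManyBody.BoseGas.IsRepulsiveFiniteRange v → (∀ᵐ r ∂(MeasureTheory.volume.restrict (Set.Ioi (0 : ℝ))), v r = 0) → ∃ ρ₀ : ℝ, 0 < ρ₀ ∧ ∀ ρ : ℝ, 0 < ρ → ρ < ρ₀ → ∃ c : ℝ, 0 < c ∧ ∀ᶠ N : ℕ in Filter.atTop, ∃ δ : ENNReal, 0 < δ ∧ ∀ Ψ : Literature.MathematicalPhysics.QuantumManyBody.BoseGas.TrialState N (Literature.MathematicalPhysics.QuantumManyBody.BoseGas.sideLength ρ N), Literature.MathematicalPhysics.QuantumManyBody.BoseGas.energy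 v Ψ ≤ Literature.MathematicalPhysics.QuantumManyBody.BoseGas.groundStateEnergy v N (Literature.MathematicalPhysics.QuantumManyBody.BoseGas.sideLength ρ N) + δ → ENNReal.ofReal (c * N) ≤ Literature.MathematicalPhysics.QuantumManyBody.BoseGas.occupation N ((Literature.MathematicalPhysics.QuantumManyBody.BoseGas.box (Literature.MathematicalPhysics.QuantumManyBody.BoseGas.sideLength ρ N)).indicator fun _ => ((Real.sqrt (Literature.MathematicalPhysics.QuantumManyBody.BoseGas.sideLength ρ N ^ 3))⁻¹ : ℂ)) Ψ.ψ

/-- `FreeGasZeroMode` holds: proved by `Summit.AtomisticToContinuum.BoseEinsteinCondensation.Theorems.BecFreeGas_proof` @ 264277954012. -/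
theorem FreeGasZeroMode_holds : FreeGasZeroMode := _root_.Summit.AtomisticToContinuum.BoseEinsteinCondensation.Theorems.BecFreeGas_proof

/-- item stmt-AtomisticToContinuum-14792 · assembly · rank 1 · open · by planner
sources: LSSY2005, Leggett2001
[assembly] GeometricRetention → WindowCondensation → FreeGasZeroMode → ContinuumTelescoping →
BoseEinsteinCondensation (the `closes` term). -/
@[route_item "route-AtomisticToContinuum-BECHierarchicalRetention"]
def Assembly : Prop :=
  GeometricRetention → WindowCondensation → FreeGasZeroMode → ContinuumTelescoping → _root_.BoseEinsteinCondensation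

/-! D-0027 §2.1 — DECIDING THEOREM (planner-authored via `route open/edit --closes-file`; by planner-plancard-AtomisticToContinuum-BoseEin-0a6d29ed-g2-0 2026-08-15T19:50:28Z):
its hypotheses are this route's items and its conclusion the sub-problem Statement (glue_lint), and it elaborates with this file. -/

@[closes "route-AtomisticToContinuum-BECHierarchicalRetention"] theorem closes (hR : GeometricRetention) (hW : WindowCondensation) (hF : FreeGasZeroMode) (hT : ContinuumTelescoping) : _root_.BoseEinsteinCondensation :=
  _root_.AtomisticToContinuum.BECInfraredBound.bec_of_zeroMode (hT hR hW hF)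

end Summit.AtomisticToContinuum.BoseEinsteinCondensation.Theses.BECHierarchicalRetention
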